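import Literature.AlgebraicGeometry.Frobenioids.PadicFrobenioidGoodLocalKit
import HarnessLib

/-!
# Frobenioids II, Example 1.1 (ii) ⇝ [IUTchI] Example 3.3 (i): `C_v^⊢ → C_v` across the two bases `D_v^⊢ ⊆ D_v`

Mochizuki, *The geometry of Frobenioids II*, Kyushu J. Math. **62** (2008) 401–460, §1, Example 1.1 (ii), p. 8
[cite: MochizukiFrdII2008, Ex 1.1 (ii) p.8]; [IUTchI] Ex. 3.3 (i): "these monoids `Φ_{C_v^⊢}`, `Φ_{C_v}` determine
`p_v`-adic Frobenioids `C_v^⊢ ⊆ C_v` […], whose base categories are given by `D_v^⊢`, `D_v` [in a fashion compatible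
with the natural inclusion `D_v^⊢ ⊆ D_v`], respectively" (with "a natural functor `D_v → D_v^⊢`, which is left-adjoint
to the natural inclusion functor `D_v^⊢ ↪ D_v`", so that `D_v^⊢ ↪ D_v → D_v^⊢` is isomorphic to the identity).

Completion of the two-base shape of `PadicFrobenioidGoodLocalKit.lean` (abc-iut-L1-t4): the remaining general brick is
the TRANSPORT of model-Frobenioid data along a natural transformation of base functors, after which the functor
`C_v^⊢ → C_v` over `D_v^⊢ ⊆ D_v` is a composite of landed pieces:

* `ModelFrobenioid.restrictAlong α` — for `α : G₂ ⟶ G₁` (functors `D' ⥤ D`) the morphism of model data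
  `(Φ|_{G₁}, B|_{G₁}) → (Φ|_{G₂}, B|_{G₂})` over `D'` given by the pull-back maps `Φ(α_A)`, `B(α_A)` (abc-iut-L1-t5's
  `DataHom`), whence `restrictAlongFunctor α`; `ModelFrobenioid.toRestrictId` — `C_Φ ⥤ C_{Φ|_{𝟭}}` (bookkeeping);
* **`GoodLocalKit.CdashToCOver ε : Cdash ⥤ CvOver`** for `ε : incl ⋙ proj ⟶ 𝟭 D` (the counit of `proj ⊣ incl`):
  `C_v^⊢ → C_v|_{D_v^⊢} → (C_v)`'s data restricted along `incl ⋙ proj` `→` (base change along `incl`) `C_v` over `D_v`;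
  `CdashToCOver_comp_baseFunctor` — it covers `incl : D_v^⊢ → D_v` on bases ("in a fashion compatible with the natural
  inclusion"); `CdashToCOver_faithful` — faithful for `incl` faithful and `ε` an isomorphism (abc-iut-L5-t2's ask),
  via `ModelFrobenioid.restrictAlongFunctor_faithful` / `toRestrictId_faithful` / `baseChange_faithful`.
-/

noncomputable section

namespace Literature.AlgebraicGeometry.Frobenioids

open CategoryTheory Opposite Function

/-! ### Transport of model data along a natural transformation of base functors -/

namespace ModelFrobenioid

universe w v v' u u'

variable {D : Type u} [Category.{v} D] {D' : Type u'} [Category.{v'} D'] {G₁ G₂ : D' ⥤ D} (α : G₂ ⟶ G₁)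
  (Φ B : Dᵒᵖ ⥤ CommMonCat.{w}) (DivB : B ⟶ monoidGp Φ)

/-- **Restriction along `α : G₂ ⟶ G₁`**: the morphism of model data `(Φ|_{G₁}, B|_{G₁}, Div) → (Φ|_{G₂}, B|_{G₂}, Div)`
over `D'` whose components are the pull-back maps `Φ(α_{A'})`, `B(α_{A'})` along `α_{A'} : G₂ A' → G₁ A'`
(compatibility with `Div_B` = naturality of `Div_B`). [cite: MochizukiFrdI2008, Thm. 5.2(i) p.100] -/
def restrictAlong : DataHom (divBRestrict G₁ Φ B DivB) (divBRestrict G₂ Φ B DivB) where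
  η := Functor.whiskerRight (NatTrans.op α) Φ
  β := Functor.whiskerRight (NatTrans.op α) B
  comm A u := by
    change MonGp.map (Φ.map (α.app A.unop).op).hom (divB Φ B DivB (op (G₁.obj A.unop)) u) =
      divB Φ B DivB (op (G₂.obj A.unop)) ((B.map (α.app A.unop).op).hom u)
    exact pullGp_divB (α.app A.unop) u

/-- The induced functor `C_{Φ|_{G₁}} ⥤ C_{Φ|_{G₂}}` over `D'` (abc-iut-L1-t5's `DataHom.functor`).
[cite: MochizukiFrdI2008, Prop. 5.3 p.103] -/
def restrictAlongFunctor :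
    ModelFrobenioid (G₁.op ⋙ Φ) (G₁.op ⋙ B) (divBRestrict G₁ Φ B DivB) ⥤
      ModelFrobenioid (G₂.op ⋙ Φ) (G₂.op ⋙ B) (divBRestrict G₂ Φ B DivB) :=
  (restrictAlong α Φ B DivB).functor

/-- It is the identity on base objects. [cite: MochizukiFrdI2008, Prop. 5.3 p.103] -/
theorem restrictAlongFunctor_comp_baseFunctor :
    restrictAlongFunctor α Φ B DivB ⋙ baseFunctor _ _ _ = baseFunctor _ _ _ := rfl

/-- Bookkeeping: `C_Φ ⥤ C_{Φ|_{𝟭_D}}` (the data restricted along the identity functor are the data).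
[cite: MochizukiFrdI2008, Thm. 5.2(i) p.100] -/
def toRestrictId : ModelFrobenioid Φ B DivB ⥤
    ModelFrobenioid ((𝟭 D).op ⋙ Φ) ((𝟭 D).op ⋙ B) (divBRestrict (𝟭 D) Φ B DivB) where
  obj X := ⟨X.base, X.cls⟩
  map {X Y} φ :=
    { degFr := Hom.degFr (X := X) (Y := Y) φ
      base := Hom.base (X := X) (Y := Y) φ
      div := Hom.div (X := X) (Y := Y) φ
      unit := Hom.unit (X := X) (Y := Y) φ
      rel := Hom.rel (X := X) (Y := Y) φ }
  map_id X := by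
    apply hom_ext <;> rfl
  map_comp {X Y Z} φ ψ := by
    apply hom_ext <;> rfl

/-- `toRestrictId` is the identity on base objects. [cite: MochizukiFrdI2008, Thm. 5.2(i) p.100] -/
theorem toRestrictId_comp_baseFunctor : toRestrictId Φ B DivB ⋙ baseFunctor _ _ _ = baseFunctor Φ B DivB := rfl

end ModelFrobenioid

/-! ### `C_v^⊢ → C_v` over `D_v^⊢ ⊆ D_v` -/

namespace PadicFrd

namespace GoodLocalKit

universe v v' u

variable {D : Type u} [Category.{v} D] {p : ℕ} [Fact p.Prime] (base : D ⥤ PadicFld.{u} p)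
  (hloc : ∀ A : D, (base.obj A).IsPadicLocal) (hc : IsConnected D) (he : IsTotallyEpimorphic D)
  {Dv : Type u} [Category.{v'} Dv] (proj : Dv ⥤ D)
  (hlocv : ∀ A : Dv, ((proj ⋙ base).obj A).IsPadicLocal) (hcv : IsConnected Dv) (hev : IsTotallyEpimorphic Dv)
  (incl : D ⥤ Dv) (ε : incl ⋙ proj ⟶ 𝟭 D)

/-- **`C_v^⊢ → C_v` across the bases `incl : D_v^⊢ → D_v`** (for `ε : incl ⋙ proj ⟶ 𝟭`, e.g. the counit of
`proj ⊣ incl`): `C^⊢ → C|_{D_v^⊢}` (inclusion of data) `→` the data restricted along `incl ⋙ proj` (transport along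
`ε`) `→ C_v` over `D_v` (base change along `incl`). [cite: MochizukiFrdII2008, Ex 1.1 (ii) p.8] -/
def CdashToCOver : Cdash base hloc hc he ⥤ CvOver base proj hlocv hcv hev :=
  CdashToC base hloc hc he ⋙ ModelFrobenioid.toRestrictId _ _ _ ⋙
    ModelFrobenioid.restrictAlongFunctor (G₁ := 𝟭 D) (G₂ := incl ⋙ proj) ε _ _ (Datum.perf base hloc hc he).divB ⋙
      ModelFrobenioid.baseChange incl _ _ (Datum.perf (proj ⋙ base) hlocv hcv hev).divB

/-- On bases, `C_v^⊢ → C_v` covers `incl : D_v^⊢ → D_v` ("in a fashion compatible with the natural inclusion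
`D_v^⊢ ⊆ D_v`"). [cite: MochizukiFrdII2008, Ex 1.1 (ii) p.8] -/
theorem CdashToCOver_comp_baseFunctor :
    CdashToCOver base hloc hc he proj hlocv hcv hev incl ε ⋙ ModelFrobenioid.baseFunctor _ _ _ =
      CdashBase base hloc hc he ⋙ incl := rfl

end GoodLocalKit

end PadicFrd

/-! ### Faithfulness (asked by abc-iut-L5-t2: `ε` an isomorphism ⇒ `C_v^⊢ → C_v` faithful) -/

namespace ModelFrobenioid

universe w v v' u u'

variable {D : Type u} [Category.{v} D] {D' : Type u'} [Category.{v'} D'] {G₁ G₂ : D' ⥤ D} (α : G₂ ⟶ G₁)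
  (Φ B : Dᵒᵖ ⥤ CommMonCat.{w}) (DivB : B ⟶ monoidGp Φ)

/-- The underlying map of an isomorphism of `CommMonCat` is injective. [cite: MochizukiFrdI2008, Def. 1.1(ii) p.19] -/
private theorem injective_hom_of_isIso {X Y : CommMonCat.{w}} (f : X ⟶ Y) [IsIso f] : Injective f.hom := by
  intro x y h
  have h' := congrArg (inv f).hom h
  change (f ≫ inv f).hom x = (f ≫ inv f).hom y at h'
  rwa [IsIso.hom_inv_id] at h'

/-- `restrictAlongFunctor α` is faithful when `α` is a (pointwise) isomorphism: its effect on `(d, f, Div, u)` is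
`(d, f, Φ(α)(Div), B(α)(u))` with `Φ(α)`, `B(α)` bijective. [cite: MochizukiFrdI2008, Prop. 5.3 p.103] -/
theorem restrictAlongFunctor_faithful [IsIso α] : (restrictAlongFunctor α Φ B DivB).Faithful := by
  refine ⟨fun {X Y} φ ψ h => ?_⟩
  let F := restrictAlongFunctor α Φ B DivB
  haveI : IsIso (Φ.map (α.app X.base).op) := inferInstance
  haveI : IsIso (B.map (α.app X.base).op) := inferInstance
  apply hom_ext
  · exact congrArg (fun χ : F.obj X ⟶ F.obj Y => Hom.degFr χ) h
  · exact congrArg (fun χ : F.obj X ⟶ F.obj Y => Hom.base χ) h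
  · exact injective_hom_of_isIso (Φ.map (α.app X.base).op) (congrArg (fun χ : F.obj X ⟶ F.obj Y => Hom.div χ) h)
  · exact injective_hom_of_isIso (B.map (α.app X.base).op) (congrArg (fun χ : F.obj X ⟶ F.obj Y => Hom.unit χ) h)

/-- `toRestrictId` is faithful (it is the identity on all components). [cite: MochizukiFrdI2008, Thm. 5.2(i) p.100] -/
theorem toRestrictId_faithful : (toRestrictId Φ B DivB).Faithful := by
  refine ⟨fun {X Y} φ ψ h => ?_⟩
  let F := toRestrictId Φ B DivB
  apply hom_ext
  · exact congrArg (fun χ : F.obj X ⟶ F.obj Y => Hom.degFr χ) h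
  · exact congrArg (fun χ : F.obj X ⟶ F.obj Y => Hom.base χ) h
  · exact congrArg (fun χ : F.obj X ⟶ F.obj Y => Hom.div χ) h
  · exact congrArg (fun χ : F.obj X ⟶ F.obj Y => Hom.unit χ) h

end ModelFrobenioid

namespace PadicFrd.GoodLocalKit

universe v v' u

variable {D : Type u} [Category.{v} D] {p : ℕ} [Fact p.Prime] (base : D ⥤ PadicFld.{u} p)
  (hloc : ∀ A : D, (base.obj A).IsPadicLocal) (hc : IsConnected D) (he : IsTotallyEpimorphic D)
  {Dv : Type u} [Category.{v'} Dv] (proj : Dv ⥤ D)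
  (hlocv : ∀ A : Dv, ((proj ⋙ base).obj A).IsPadicLocal) (hcv : IsConnected Dv) (hev : IsTotallyEpimorphic Dv)
  (incl : D ⥤ Dv) (ε : incl ⋙ proj ⟶ 𝟭 D)

/-- **`C_v^⊢ → C_v` (two bases) is faithful** when `incl` is faithful and `ε` is an isomorphism (e.g. the counit of
`proj ⊣ incl` with `incl` fully faithful). [cite: MochizukiFrdII2008, Ex 1.1 (ii) p.8] -/
theorem CdashToCOver_faithful [incl.Faithful] [IsIso ε] :
    (CdashToCOver base hloc hc he proj hlocv hcv hev incl ε).Faithful := by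
  haveI h1 := CdashToC_faithful base hloc hc he
  haveI h2 := ModelFrobenioid.toRestrictId_faithful (Datum.perf base hloc hc he).Φ (Datum.perf base hloc hc he).B
    (Datum.perf base hloc hc he).divB
  haveI h3 := ModelFrobenioid.restrictAlongFunctor_faithful (G₁ := 𝟭 D) (G₂ := incl ⋙ proj) ε
    (Datum.perf base hloc hc he).Φ (Datum.perf base hloc hc he).B (Datum.perf base hloc hc he).divB
  haveI h4 := ModelFrobenioid.baseChange_faithful incl (Datum.perf (proj ⋙ base) hlocv hcv hev).Φ
    (Datum.perf (proj ⋙ base) hlocv hcv hev).B (Datum.perf (proj ⋙ base) hlocv hcv hev).divB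
  refine ⟨fun {X Y} φ ψ h => ?_⟩
  exact (CdashToC base hloc hc he).map_injective
    ((ModelFrobenioid.toRestrictId (Datum.perf base hloc hc he).Φ (Datum.perf base hloc hc he).B
        (Datum.perf base hloc hc he).divB).map_injective
      ((ModelFrobenioid.restrictAlongFunctor (G₁ := 𝟭 D) (G₂ := incl ⋙ proj) ε (Datum.perf base hloc hc he).Φ
          (Datum.perf base hloc hc he).B (Datum.perf base hloc hc he).divB).map_injective
        ((ModelFrobenioid.baseChange incl (Datum.perf (proj ⋙ base) hlocv hcv hev).Φ
            (Datum.perf (proj ⋙ base) hlocv hcv hev).B (Datum.perf (proj ⋙ base) hlocv hcv hev).divB).map_injective h)))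

end PadicFrd.GoodLocalKit

end Literature.AlgebraicGeometry.Frobenioids
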